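import Literature.Computability.AlgebraicComplexity.BorderDcQuadraticBoundProofs
import Literature.Computability.AlgebraicComplexity.HwvIdealDegreeCriterion
import Literature.Computability.AlgebraicComplexity.DeterminantIrreducible
import Mathlib.RingTheory.Nullstellensatz
import Mathlib.Algebra.MvPolynomial.NoZeroDivisors
import HarnessLib

/-!
# Landsberg–Manivel–Ressayre's equations for `det_n`: the ideal of `\overline{GL_{n²}·det_n}` is
# nonzero in degree `2n(n−1)`, for every `n ≥ 3` — as a theorem

Topic `Computability/AlgebraicComplexity` (geometric complexity theory). Sibling proof file of
`LMRDetIdealModule.lean` (the named fact `LMR2013_thm_1_1_2_1`: for every `n ≥ 3` a nonzero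
highest-weight vector of weight `λ(n)^*`, `λ(n) = (2n³−4n²+1, 2n²−4n+1, 2^{2n−1}) ⊢ n·2n(n−1)`, lies in
the ideal of `GL_{n²}·det_n`) and of `LMRDetThreeIdealModule.lean` (its `n = 3` instance, cell
`pub-gct`). Written for the cell `pub-gct-max` (track T); honest framing of that cell: multiplicity
data and certified bounds at small parameters — nothing here is a claim on VP ≠ VNP or P ≠ NP.

**What this file proves, fact-free** (`exists_hwv_idealDet`, `exists_partition_hwv_idealDet`): for
every `n ≥ 3` the ideal `orbitVanishingIdeal (detFormLex ℂ n) n` of `GL_{n²}·det_n` in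
`ℂ[Sym^n(ℂ^{n×n})] = coordRep (MatIdx n) ℂ n` contains a NONZERO highest-weight vector (lexicographic
upper Borel), homogeneous of degree `2n(n−1)`; equivalently some partition `λ ⊢ n·2n(n−1)` with at
most `n²` parts has `mult_{λ^*} ℂ[Δ(det_n)] < a_{λ^*}` — the DEGREE STATEMENT of LMR Thm. 1.1.2 (1)
/ §3.2 ("a copy of the module … in `S^{2n(n−1)}(S^n ℂ^{n²})` is in the ideal of
`\overline{GL(W)·[det_n]}`", p. 476): `24` for `det_4`, `40` for `det_5`, `60` for `det_6`. In the
cell's language: the least degree `e(n)` of an equation of `Δ(det_n)` satisfies `e(n) ≤ 2n(n−1)` by a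
kernel-checked theorem (the tree knew `e(3) ≤ 12` only through the cited fact
`LMR2013_detThree_idealHwv`, and `e(n) > n`-type lower bounds from `PlethysmFirstRowVanishing`).

**What is NOT proved here.** The WEIGHT of the equation — that LMR's equation attached to the flag
of the `2n+1` greatest coordinates (`lmrFlag`) is itself a highest-weight vector of weight `λ(n)^*`
(LMR §2.3, eqs. (4)–(5): torus exponents `(2+e+(d−1)(e−d+1), e−d+3, 2^{(k+1)})`), which would
discharge `LMR2013_thm_1_1_2_1` (and, at `n = 3`, `LMR2013_detThree_idealHwv`); Thm. 2.3.1 for a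
general `Dual_{k,d,N}`; Thm. 1.1.2 (2) and Thm. 3.1.1 (irreducible component, smoothness). The
machinery below (§§1–6, 8) is stated for a general form `P`, flag and commutative ring so that the
weight computation can be added on top of it.

**The printed argument (LMR 2013 §2, §3.1) and how it is formalised.**
* §2.1 (p. 472) "Segre's formula implies that `Z(P)^*` has dimension less or equal to `k` if and only
  if, for any `w ∈ W` such that `P(w) = 0`, and any `(k+3)`-dimensional subspace `F` of `W`,
  `det(H_{P,w}|_F) = 0`. Equivalently (assuming `P` is irreducible), for any such subspace `F`, the
  polynomial `P` must divide `det(H_P|_F)`, a polynomial of degree `(k+3)(d−2)`."  Here (§4, for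
  `P ∈ GL_{n²}·det_n`, `k + 3 = 2n + 1`): every such `P` is the determinant of a matrix of linear
  forms, so its Hessian has rank `≤ 2n` wherever `P` vanishes (Mignon–Ressayre; the tree's
  `rank_hessianMatrix_le_two_mul_of_isAffineDetRepr`, replacing Segre's formula and
  `Z(det_n)^∨ = Seg(ℙ^{n−1}×ℙ^{n−1})`), hence every generalised `(2n+1)`-minor `det(U H_P Vᵀ)`
  vanishes on `Z(P)`; `P` is prime (`detPoly_prime` transported along renaming and `GL_{n²}`), so
  `P ∣ det(U H_P Vᵀ)` by the Nullstellensatz (`linSubst_detFormLex_dvd_hessGenMinor`).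
* §2.2 (pp. 472–473), eqs. (1)–(3): restrict `P` and `Q` to a plane `L` with coordinates `x, y`
  ("Divide equation (1) by `P_L(x, y)` and set `x = 1`. We get an identity between power series in
  `y`, to which `D_L` contributes only up to degree `e − d`"): the coefficient `R̂(Q,P)` of `y^{e−d+1}`
  in `Q_L(1,y) · Σ_m (−1)^m π(y)^m`, cleared of denominators (eq. (2)), "is linear in the
  coefficients of `Q_L`, and of degree `e − d + 1` in those of `P_L`", vanishes when `P_L` divides
  `Q_L`, and rescales by (3).  Here: `planeRestr x y P = P(e_x + Y e_y) = P_L(1, Y)`, `lmrS` (the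
  truncated series), `lmrR` (eq. (2)); `mul_lmrS` is the division identity behind (1)–(2),
  `lmrR_eq_zero_of_eq_mul` the vanishing — with no hypothesis on `p_d` —, `lmrR_smul` is (3) (§1).
* §2.3 (pp. 473–474): with `Q = det(H_P|_F)`, `e = (k+3)(d−2)`, and `L ⊂ F` "we get an equation
  depending only on the partial flag `D ⊂ L ⊂ F`", of degree `(k+2)(d−1)` (Thm. 2.3.1).  Here:
  `lmrEq f M P = R̂_M(P_L(1,Y), det(H_P|_F)_L(1,Y))` for a coordinate flag `f : Fin (r+2) → ι` (§2),
  `M = e − d + 1 = lmrDegM n = (2n+1)(n−2) − n + 1` for `det_n` (§4); as an element `lmrEqCoord` of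
  the coordinate ring `k[Sym^m]` it is homogeneous of degree `(r+2) + M` (`= 2n(n−1)` for `det_n`)
  by the scaling law and `isHomogeneous_of_eval_smul` (§§5–6), lies in the orbit ideal as soon as it
  vanishes on the orbit (§6), and is nonzero as soon as it does not vanish at ONE form (§6).
* Non-vanishing. LMR obtain it from the module structure; here (§§8–9, a shorter road in Lean) the
  equation of ANY injective flag `(x, y, z_0, …, z_{2n−2})` is evaluated at the test form
  `W_n = x^n + y^n + z_0² x^{n−3} y + Σ_{c≥1} z_c² x^{n−2}` (ours, not in the source):
  `W_n(e_x + Y e_y) = 1 + Y^n`, the restricted Hessian on `F` is diagonal with determinant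
  `n²(n−1)² 2^{2n−1} Y^{n−1}`, and `E(W_n) = (n(n−1))² 2^{2n−1} (−1)^{2n−5} ≠ 0` (`lmrEq_lmrWitness`).
* §10: with the flag `lmrFlag n` of the `2n+1` greatest matrix positions, the nonzero homogeneous
  element `lmrEqCoord` of degree `2n(n−1)` of the (graded, `GL`-stable) ideal yields a nonzero
  highest-weight vector of the same degree (Bürgisser–Ikenmeyer 2013 Prop. 3.3; the tree's
  `exists_hwv_of_mem_orbitVanishingIdeal`), and a weight pins a partition `λ ⊢ n·2n(n−1)` with
  `≤ n²` parts (`exists_eq_dualOfPartition_of_hasHighestWeight_orbitCoordRep_of_size_eq`) and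
  `mult < a` (`orbitMultiplicity_lt_plethysmCoeff_of_mem_orbitVanishingIdeal`).

Definitions are plumbing with bodies (`lmrS`, `lmrR`, `selMatrix`, `planeRestr`, `lmrEq`, `lmrDegM`,
`linSubstAlgEquiv`, `genericFormDeg`, `lmrEqCoord`, `witnessGamma`, `lmrWitness`, `witnessDiag`,
`lmrFlag`); no named facts (net debt `0`). `totalDegree_pderiv_le_pred` restates the
8-line lemma `totalDegree_pderiv_le_sub_one` of `Lickteig1985TypicalRank444Proofs.lean` rather than
importing the `4×4×4` border-rank development into the GCT cone.

## References
* [LandsbergManivelRessayre2013] J. M. Landsberg, L. Manivel, N. Ressayre, *Hypersurfaces with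
  degenerate duals and the geometric complexity theory program*, Comment. Math. Helv. 88 (2013)
  469–484 (doi:10.4171/CMH/292; arXiv:1004.4802): §2.1–2.3 with eqs. (1)–(5) (pp. 472–474),
  Thm. 2.3.1 (p. 474), §3.1 and Thm. 3.1.1 (pp. 475–476), §3.2 (p. 476), Thm. 1.1.2 (p. 470)
  `[corpus:paper:galaxy-pdf-8572435590081880720 p0004–p0008]`.
* [MignonRessayre2004] T. Mignon, N. Ressayre, *A quadratic bound for the determinant and permanent
  problem*, IMRN 2004:79, §2 (rank of the Hessian of a determinantal polynomial on its zero set).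
* [BurgisserIkenmeyer2013] P. Bürgisser, C. Ikenmeyer, STOC 2013 = arXiv:1210.8368, §3.3 Prop. 3.3.
* [Humphreys1990] J. E. Humphreys, *Reflection groups and Coxeter groups*, CUP 1990, §3.10 (degree
  drop under `∂_i`, as cited by `Lickteig1985TypicalRank444Proofs.lean`).

## Mathlib and tree
Tree: `lineRestr`, `hessPoly`, `hessGenMinor`, `det_mul_mul_transpose_eq_zero_of_rank_le`,
`lineRestr_X` (`BorderDcQuadraticBoundProofs.lean`); `rank_hessianMatrix_le_two_mul_of_isAffineDetRepr`,
`IsAffineDetRepr` (`HessianRank.lean`); `detPoly_prime`, `detFormLex`, `rename toLex` dictionary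
(`DeterminantIrreducible.lean`, `GCTObstructions.lean`); `linSubst`, `glOrbit`, `linSubst_mul`
(`LinSubst.lean`); `coordRep`, `formCoeff`, `DegIdx`, `orbitVanishingIdeal`, `mem_orbitVanishingIdeal_iff`
(`OrbitCoordinateRing.lean`); `exists_hwv_of_mem_orbitVanishingIdeal`,
`size_eq_of_mem_highestWeightSpace_of_isHomogeneous` (`HwvIdealDegreeCriterion.lean`);
`exists_eq_dualOfPartition_of_hasHighestWeight_orbitCoordRep_of_size_eq` (`OrbitClosureWeights.lean`);
`orbitMultiplicity_lt_plethysmCoeff_of_mem_orbitVanishingIdeal` (`HwvIdealRankBound.lean`);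
`matIdxEquiv`, `Weight.dualOfPartition`, `Weight.toMatIdx`, `topMatIdx`. Mathlib:
`MvPolynomial.vanishingIdeal_zeroLocus_eq_radical` (Nullstellensatz), `MvPolynomial.pderiv`,
`Polynomial.X_pow_dvd_iff`, `geom_sum₂_mul`, `Matrix.det_diagonal`, `MvPolynomial.totalDegree_mul_of_isDomain`,
`Polynomial.eq_zero_of_infinite_isRoot`.
-/

noncomputable section

open MvPolynomial Matrix Polynomial

namespace Literature.Computability.AlgebraicComplexity

/-! ### §1 The univariate remainder functional `R̂` (LMR 2013 §2.2, eq. (2)) -/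

section Univariate

variable {A : Type*} [CommRing A]

/-- LMR's truncated inverse series: for `p = c₀ + π(Y)` (`c₀ = p(0)`, `π(0) = 0`),
`S_M(p) = ∑_{i ≤ M} (−π)^i c₀^{M−i}`, so that `p · S_M(p) = c₀^{M+1} + (−1)^M π^{M+1}`.
[cite: LandsbergManivelRessayre2013, §2.2 (the expansion `1/(1+π(y)) = Σ_m (−1)^m π(y)^m`, pp.
472–473)] -/
def lmrS (M : ℕ) (p : A[X]) : A[X] :=
  ∑ i ∈ Finset.range (M + 1),
    (-(p - Polynomial.C (p.coeff 0))) ^ i * (Polynomial.C (p.coeff 0)) ^ (M + 1 - 1 - i)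

/-- LMR's remainder coefficient `R̂(q, p)` (up to the power of `p_d` making it polynomial): the
coefficient of `Y^M` in `q · S_M(p)`; it is `p(0)^{M+1}` times the coefficient of `Y^M` in the
power series `q / p` when `p(0)` is a unit.
[cite: LandsbergManivelRessayre2013, §2.2, eq. (2) (p. 473)] -/
def lmrR (M : ℕ) (p q : A[X]) : A :=
  (q * lmrS M p).coeff M

/-- The telescoping identity `p · S_M(p) = C (p(0)^{M+1}) + (−1)^M (p − C p(0))^{M+1}`.
[cite: LandsbergManivelRessayre2013, §2.2, eq. (1) (p. 472)] -/
theorem mul_lmrS (M : ℕ) (p : A[X]) :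
    p * lmrS M p = Polynomial.C (p.coeff 0) ^ (M + 1) +
      (-1) ^ M * (p - Polynomial.C (p.coeff 0)) ^ (M + 1) := by
  have h := geom_sum₂_mul (-(p - Polynomial.C (p.coeff 0))) (Polynomial.C (p.coeff 0)) (M + 1)
  rw [lmrS]
  have hp : p = -(-(p - Polynomial.C (p.coeff 0)) - Polynomial.C (p.coeff 0)) := by ring
  calc p * ∑ i ∈ Finset.range (M + 1),
        (-(p - Polynomial.C (p.coeff 0))) ^ i * Polynomial.C (p.coeff 0) ^ (M + 1 - 1 - i)
      = -((∑ i ∈ Finset.range (M + 1),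
          (-(p - Polynomial.C (p.coeff 0))) ^ i * Polynomial.C (p.coeff 0) ^ (M + 1 - 1 - i)) *
          (-(p - Polynomial.C (p.coeff 0)) - Polynomial.C (p.coeff 0))) := by
        conv_lhs => rw [hp]
        ring
    _ = _ := by rw [h, neg_pow, pow_succ (-1 : A[X]) M]; ring

/-- **Divisibility kills `R̂`** (LMR §2.2: "`P_L` divides `Q_L`" ⇒ the remainder vanishes): if
`q = p · D` with `deg D < M` then `R̂_M(q, p) = 0` — with NO hypothesis on `p(0)`.
[cite: LandsbergManivelRessayre2013, §2.2, eqs. (1)–(2) ("`D_L` contributes only up to degree `e −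
d`")] -/
theorem lmrR_eq_zero_of_eq_mul (M : ℕ) {p q D : A[X]} (hq : q = p * D) (hD : D.natDegree < M) :
    lmrR M p q = 0 := by
  rw [lmrR, hq, mul_assoc, mul_comm D, ← mul_assoc, mul_lmrS, add_mul, Polynomial.coeff_add]
  have h1 : (Polynomial.C (p.coeff 0) ^ (M + 1) * D).coeff M = 0 := by
    rw [← Polynomial.C_pow, Polynomial.coeff_C_mul, Polynomial.coeff_eq_zero_of_natDegree_lt hD,
      mul_zero]
  have h2 : ((-1) ^ M * (p - Polynomial.C (p.coeff 0)) ^ (M + 1) * D).coeff M = 0 := by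
    have hX : (Polynomial.X : A[X]) ∣ p - Polynomial.C (p.coeff 0) := by
      rw [Polynomial.X_dvd_iff]
      simp
    have hXM : (Polynomial.X : A[X]) ^ (M + 1) ∣
        (-1) ^ M * (p - Polynomial.C (p.coeff 0)) ^ (M + 1) * D :=
      ((pow_dvd_pow_of_dvd hX (M + 1)).mul_left _).mul_right _
    exact (Polynomial.X_pow_dvd_iff.mp hXM) M (Nat.lt_succ_self M)
  rw [h1, h2, add_zero]

/-- `R̂` vanishes when `q = 0`.
[cite: LandsbergManivelRessayre2013, §2.2, eq. (2) ("linear in the coefficients of `Q_L`")] -/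
theorem lmrR_zero_right (M : ℕ) (p : A[X]) : lmrR M p 0 = 0 := by
  simp [lmrR]

/-- Base change for `S_M`. [cite: LandsbergManivelRessayre2013, §2.2, eq. (2)] -/
theorem map_lmrS {B : Type*} [CommRing B] (φ : A →+* B) (M : ℕ) (p : A[X]) :
    (lmrS M p).map φ = lmrS M (p.map φ) := by
  simp [lmrS, Polynomial.map_sum, Polynomial.map_mul, Polynomial.map_pow, Polynomial.map_sub,
    Polynomial.coeff_map]

/-- Base change for `R̂`.
[cite: LandsbergManivelRessayre2013, §2.2, eq. (2) ("a polynomial equation in the coefficients of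
`Q_L` and `P_L`")] -/
theorem map_lmrR {B : Type*} [CommRing B] (φ : A →+* B) (M : ℕ) (p q : A[X]) :
    φ (lmrR M p q) = lmrR M (p.map φ) (q.map φ) := by
  rw [lmrR, lmrR, ← Polynomial.coeff_map, Polynomial.map_mul, map_lmrS]

/-- Scaling: `S_M(t p) = t^M S_M(p)`.
[cite: LandsbergManivelRessayre2013, §2.2, eq. (3) (rescaling, `λ = 1`)] -/
theorem lmrS_smul (M : ℕ) (t : A) (p : A[X]) :
    lmrS M (Polynomial.C t * p) = Polynomial.C t ^ M * lmrS M p := by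
  rw [lmrS, lmrS, Finset.mul_sum]
  refine Finset.sum_congr rfl fun i hi => ?_
  have hi' : i ≤ M := by
    have := Finset.mem_range.mp hi
    omega
  have hc : (Polynomial.C t * p).coeff 0 = t * p.coeff 0 := by simp
  have hneg : -(Polynomial.C t * p - Polynomial.C ((Polynomial.C t * p).coeff 0)) =
      Polynomial.C t * (-(p - Polynomial.C (p.coeff 0))) := by
    rw [hc, map_mul]
    ring
  have hC : Polynomial.C ((Polynomial.C t * p).coeff 0) =
      Polynomial.C t * Polynomial.C (p.coeff 0) := by
    rw [hc, map_mul]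
  rw [hneg, hC, mul_pow, mul_pow]
  obtain ⟨j, rfl⟩ := Nat.exists_eq_add_of_le hi'
  have hM : i + j + 1 - 1 - i = j := by omega
  rw [hM, pow_add]
  ring

/-- Scaling: `R̂_M(s q, t p) = s t^M R̂_M(q, p)`.
[cite: LandsbergManivelRessayre2013, §2.2, eq. (3) (`R̂(αQ, βP) = α β^{e−d+1} R̂(Q, P)`)] -/
theorem lmrR_smul (M : ℕ) (s t : A) (p q : A[X]) :
    lmrR M (Polynomial.C t * p) (Polynomial.C s * q) = s * t ^ M * lmrR M p q := by
  rw [lmrR, lmrR, lmrS_smul]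
  have : Polynomial.C s * q * (Polynomial.C t ^ M * lmrS M p) =
      Polynomial.C (s * t ^ M) * (q * lmrS M p) := by
    rw [map_mul, map_pow]; ring
  rw [this, Polynomial.coeff_C_mul]

end Univariate

/-! ### §2 The equation functional `E(P) = R̂_M(P|_L(1,Y), det(H_P|_F)|_L(1,Y))` -/

section Equation

variable {A : Type*} [CommRing A] {ι : Type*} [Fintype ι] [DecidableEq ι] {r : ℕ}

/-- The `0/1` selection matrix of a family of coordinates `f : Fin r → ι` (rows `e_{f a}`).
[cite: LandsbergManivelRessayre2013, §2.1 (`H_P|_F`, p. 472)] -/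
def selMatrix (f : Fin r → ι) : Matrix (Fin r) ι A :=
  Matrix.of fun a i => if i = f a then 1 else 0

omit [Fintype ι] in
/-- Base change fixes the selection matrix. [cite: LandsbergManivelRessayre2013, §2.1] -/
theorem selMatrix_map {B : Type*} [CommRing B] (φ : A →+* B) (f : Fin r → ι) :
    (selMatrix (A := A) f).map φ = selMatrix f := by
  ext a i
  simp only [selMatrix, Matrix.map_apply, Matrix.of_apply]
  split_ifs <;> simp

/-- The restriction `P ↦ P(e_x + Y e_y)` to the coordinate plane `⟨e_x, e_y⟩`, dehomogenised at
`x = 1` (LMR's `P_L(1, y)`).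
[cite: LandsbergManivelRessayre2013, §2.2 ("restrict `P` and `Q` to some plane `L` … set `y = 1`",
p. 472)] -/
abbrev planeRestr (x y : ι) : MvPolynomial ι A →ₐ[A] A[X] :=
  lineRestr (Pi.single x 1) (Pi.single y 1)

omit [Fintype ι] in
/-- Base change for the plane restriction. [cite: LandsbergManivelRessayre2013, §2.2] -/
theorem map_planeRestr {B : Type*} [CommRing B] (φ : A →+* B) (x y : ι) (P : MvPolynomial ι A) :
    (planeRestr x y P).map φ = planeRestr x y (MvPolynomial.map φ P) := by
  rw [planeRestr, map_lineRestr]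
  have hx : (φ : A → B) ∘ (Pi.single x (1 : A)) = Pi.single x (1 : B) := by
    funext i
    by_cases h : i = x
    · subst h; simp
    · simp [Pi.single_eq_of_ne h]
  have hy : (φ : A → B) ∘ (Pi.single y (1 : A)) = Pi.single y (1 : B) := by
    funext i
    by_cases h : i = y
    · subst h; simp
    · simp [Pi.single_eq_of_ne h]
  rw [hx, hy]

/-- **LMR's equation, as a scalar functional on forms** (LMR 2013 §2.2–2.3, with the coordinate
flag `D = ⟨e_{f 0}⟩ ⊂ L = ⟨e_{f 0}, e_{f 1}⟩ ⊂ F = ⟨e_{f 0}, …, e_{f (r+1)}⟩`):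
`E(P) = R̂_M(P_L(1,Y), det(H_P|_F)_L(1,Y))`.
[cite: LandsbergManivelRessayre2013, §2.3 ("we get an equation depending only on the partial flag `D
⊂ L ⊂ F`", p. 473)] -/
def lmrEq (f : Fin (r + 2) → ι) (M : ℕ) (P : MvPolynomial ι A) : A :=
  lmrR M (planeRestr (f 0) (f 1) P)
    (planeRestr (f 0) (f 1) (hessGenMinor (selMatrix f) (selMatrix f) P))

/-- Base change for `E`: `E` is "a polynomial in the coefficients".
[cite: LandsbergManivelRessayre2013, §2.2 ("considered as a polynomial equation in the coefficients
of `P` and `Q`")] -/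
theorem map_lmrEq {B : Type*} [CommRing B] (φ : A →+* B) (f : Fin (r + 2) → ι) (M : ℕ)
    (P : MvPolynomial ι A) :
    φ (lmrEq f M P) = lmrEq f M (MvPolynomial.map φ P) := by
  rw [lmrEq, lmrEq, map_lmrR, map_planeRestr, map_planeRestr, map_hessGenMinor, selMatrix_map]

omit [Fintype ι] [DecidableEq ι] in
/-- The polynomial Hessian is linear over constants: `H_{c P} = c H_P`.
[cite: LandsbergManivelRessayre2013, §2.3, eq. (5) (scaling of `H_P|_F`)] -/
theorem hessPoly_C_mul (c : A) (P : MvPolynomial ι A) :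
    hessPoly (MvPolynomial.C c * P) = (MvPolynomial.C c : MvPolynomial ι A) • hessPoly P := by
  ext i j
  simp only [hessPoly_apply, Matrix.smul_apply, smul_eq_mul]
  rw [show MvPolynomial.C c * P = c • P from (MvPolynomial.smul_eq_C_mul P c).symm,
    (pderiv j).map_smul, (pderiv i).map_smul, MvPolynomial.smul_eq_C_mul]

omit [DecidableEq ι] in
/-- Scaling of the generalised minor: `det(U H_{cP} Vᵀ) = c^r det(U H_P Vᵀ)`.
[cite: LandsbergManivelRessayre2013, §2.3, eq. (5)] -/
theorem hessGenMinor_C_mul (U V : Matrix (Fin r) ι A) (c : A) (P : MvPolynomial ι A) :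
    hessGenMinor U V (MvPolynomial.C c * P) = MvPolynomial.C c ^ r * hessGenMinor U V P := by
  rw [hessGenMinor, hessGenMinor, hessPoly_C_mul, Matrix.mul_smul, Matrix.smul_mul,
    Matrix.det_smul, Fintype.card_fin]

/-- **Scaling of `E`**: `E(c P) = c^{r+2+M} E(P)` — `E` is isobaric of degree `(r+2) + M` in the
coefficients of `P`.
[cite: LandsbergManivelRessayre2013, §2.2 eq. (3) with §2.3 eq. (5) ("of degree `e − d + 1` in those
of `P_L`", linear in `Q = det(H_P|_F)` of degree `k + 3` in `P`)] -/
theorem lmrEq_C_mul (f : Fin (r + 2) → ι) (M : ℕ) (c : A) (P : MvPolynomial ι A) :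
    lmrEq f M (MvPolynomial.C c * P) = c ^ (r + 2) * c ^ M * lmrEq f M P := by
  rw [lmrEq, lmrEq, hessGenMinor_C_mul, map_mul, map_mul, map_pow]
  have h1 : planeRestr (A := A) (f 0) (f 1) (MvPolynomial.C c) = Polynomial.C c := by
    rw [planeRestr, MvPolynomial.algHom_C, Polynomial.algebraMap_eq]
  rw [h1, ← Polynomial.C_pow, lmrR_smul]

/-- **Divisibility kills `E`**: if `det(H_P|_F) = P · D` with `deg (D|_L) < M`, then `E(P) = 0`.
[cite: LandsbergManivelRessayre2013, §2.2 ("the condition that `P` divides `Q`", eq. (1))] -/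
theorem lmrEq_eq_zero_of_eq_mul (f : Fin (r + 2) → ι) (M : ℕ) {P D : MvPolynomial ι A}
    (hQ : hessGenMinor (selMatrix f) (selMatrix f) P = P * D)
    (hD : (planeRestr (A := A) (f 0) (f 1) D).natDegree < M) : lmrEq f M P = 0 := by
  rw [lmrEq, hQ, map_mul]
  exact lmrR_eq_zero_of_eq_mul M rfl hD

end Equation

/-! ### §3 Degree bounds: `deg det(H_P|_F) ≤ r (deg P − 2)` -/

section Degree

variable {A : Type*} [CommRing A] {ι : Type*} [Fintype ι] {r : ℕ}

omit [Fintype ι] in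
/-- Sharp degree drop under a partial derivative: `deg ∂_i f ≤ deg f − 1`.
[cite: Humphreys1990, §3.10 (proof of the Proposition: "each `∂h/∂y_i` has smaller degree than
`h`")] -/
theorem totalDegree_pderiv_le_pred [DecidableEq ι] (i : ι) (f : MvPolynomial ι A) :
    (pderiv i f).totalDegree ≤ f.totalDegree - 1 := by
  classical
  refine Finset.sup_le fun m hm => ?_
  rw [MvPolynomial.mem_support_iff, coeff_pderiv] at hm
  have hm' : m + Finsupp.single i 1 ∈ f.support := by
    rw [MvPolynomial.mem_support_iff]
    intro h
    exact hm (by rw [h, zero_mul])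
  have hle := le_totalDegree hm'
  rw [Finsupp.sum_add_index' (fun _ => rfl) (fun _ _ _ => rfl), Finsupp.sum_single_index rfl]
    at hle
  change (m.sum fun _ e => e) ≤ _
  omega

/-- Degree bound for the generalised minor from a uniform bound on the second partials:
`deg ∂_i∂_j f ≤ b` for all `i, j` gives `deg det(U H_f Vᵀ) ≤ r b`.
[cite: LandsbergManivelRessayre2013, §2.1 ("`det(H_P|_F)`, a polynomial of degree `(k+3)(d−2)`")] -/
theorem totalDegree_hessGenMinor_le_of_forall [DecidableEq ι] (U V : Matrix (Fin r) ι A)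
    (f : MvPolynomial ι A) {b : ℕ} (hb : ∀ i j, (pderiv i (pderiv j f)).totalDegree ≤ b) :
    (hessGenMinor U V f).totalDegree ≤ r * b := by
  classical
  have hentry : ∀ a c, ((U.map (MvPolynomial.C : A →+* MvPolynomial ι A) * hessPoly f *
      (V.map (MvPolynomial.C : A →+* MvPolynomial ι A))ᵀ) a c).totalDegree ≤ b := by
    intro a c
    rw [Matrix.mul_apply]
    refine totalDegree_finsetSum_le fun j _ => ?_
    refine (totalDegree_mul _ _).trans ?_
    rw [Matrix.transpose_apply, Matrix.map_apply, totalDegree_C, add_zero, Matrix.mul_apply]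
    refine totalDegree_finsetSum_le fun i _ => ?_
    refine (totalDegree_mul _ _).trans ?_
    rw [Matrix.map_apply, totalDegree_C, zero_add, hessPoly_apply]
    exact hb i j
  rw [hessGenMinor, Matrix.det_apply]
  refine totalDegree_finsetSum_le fun σ _ => ?_
  rw [Units.smul_def, zsmul_eq_mul, ← map_intCast (MvPolynomial.C : A →+* MvPolynomial ι A)]
  refine (totalDegree_mul _ _).trans ?_
  rw [totalDegree_C, zero_add]
  refine (totalDegree_finsetProd _ _).trans ?_
  refine (Finset.sum_le_sum fun a _ => hentry (σ a) a).trans ?_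
  simp

/-- For a form of degree `d`: `deg det(U H_P Vᵀ) ≤ r (d − 2)`.
[cite: LandsbergManivelRessayre2013, §2.1 ("a polynomial of degree `(k+3)(d−2)`", p. 472)] -/
theorem totalDegree_hessGenMinor_le_of_isHomogeneous [DecidableEq ι] (U V : Matrix (Fin r) ι A)
    {P : MvPolynomial ι A} {d : ℕ} (hP : P.IsHomogeneous d) :
    (hessGenMinor U V P).totalDegree ≤ r * (d - 2) := by
  refine totalDegree_hessGenMinor_le_of_forall U V P fun i j => ?_
  have h1 := totalDegree_pderiv_le_pred i (pderiv j P)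
  have h2 := totalDegree_pderiv_le_pred j P
  have h3 := hP.totalDegree_le
  omega

end Degree

/-! ### §4 The orbit side: `E` vanishes on `GL_{n²} · det_n` (LMR §2.1, §3.1) -/

section OrbitSide

open _root_.Literature.NumberTheory.DiophantineGeometry

/-- Hilbert's Nullstellensatz for a prime hypersurface: if `P` is prime and `Q` vanishes on the
zeros of `P` (over an algebraically closed field), then `P ∣ Q`.
[cite: LandsbergManivelRessayre2013, §2.1 ("Equivalently (assuming `P` is irreducible) … `P` must
divide `det(H_P|_F)`"; Hilbert's Nullstellensatz)] -/
theorem dvd_of_prime_of_forall_eval_eq_zero {σ : Type*} [Finite σ] {K : Type*} [Field K]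
    [IsAlgClosed K] {P Q : MvPolynomial σ K} (hP : Prime P)
    (h : ∀ x : σ → K, MvPolynomial.eval x P = 0 → MvPolynomial.eval x Q = 0) : P ∣ Q := by
  have hQ : Q ∈ MvPolynomial.vanishingIdeal K
      (MvPolynomial.zeroLocus K (Ideal.span {P} : Ideal (MvPolynomial σ K))) := by
    rw [MvPolynomial.mem_vanishingIdeal_iff]
    intro x hx
    rw [MvPolynomial.mem_zeroLocus_iff] at hx
    have hxP := hx P (Ideal.subset_span rfl)
    exact h x hxP
  rw [MvPolynomial.vanishingIdeal_zeroLocus_eq_radical] at hQ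
  obtain ⟨r, hr⟩ := hQ
  rw [Ideal.mem_span_singleton] at hr
  exact hP.dvd_of_dvd_pow hr

variable {n : ℕ}

/-- Every element `G · det_n` of `End · det_n` (in the lexicographic matrix variables) is the
determinant of a matrix of linear forms: an affine determinantal representation of size `n`.
[cite: MignonRessayre2004, §2 (the Hessian of a determinantal representation)] -/
theorem isAffineDetRepr_linSubst_detFormLex (G : Matrix (MatIdx n) (MatIdx n) ℂ) :
    IsAffineDetRepr (linSubst (MatIdx n) ℂ G (detFormLex ℂ n))
      (((Matrix.mvPolynomialX (Fin n) (Fin n) ℂ).map (rename toLex)).map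
        (linSubst (MatIdx n) ℂ G)) := by
  refine ⟨fun i j => ?_, ?_⟩
  · rw [Matrix.map_apply, Matrix.map_apply, Matrix.mvPolynomialX_apply, rename_X, linSubst_X]
    exact totalDegree_finsetSum_le fun l _ =>
      (totalDegree_smul_le _ _).trans (totalDegree_X (R := ℂ) l).le
  · rw [detFormLex, detPoly, AlgHom.map_det, AlgHom.map_det]
    rfl

/-- `linSubst` by an invertible matrix is a `k`-algebra automorphism.
[cite: LandsbergManivelRessayre2013, §2.1 ("If `P` is irreducible …": irreducibility is transported
along `GL(W)`)] -/
def linSubstAlgEquiv {σ k : Type*} [Fintype σ] [DecidableEq σ] [Field k] (g : GL σ k) :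
    MvPolynomial σ k ≃ₐ[k] MvPolynomial σ k :=
  AlgEquiv.ofAlgHom (linSubst σ k (g : Matrix σ σ k)) (linSubst σ k (g⁻¹ : GL σ k))
    (by rw [← linSubst_mul, Units.mul_inv, linSubst_one])
    (by rw [← linSubst_mul, Units.inv_mul, linSubst_one])

/-- Unfolding of `linSubstAlgEquiv`. [cite: LandsbergManivelRessayre2013, §2.1] -/
theorem linSubstAlgEquiv_apply {σ k : Type*} [Fintype σ] [DecidableEq σ] [Field k] (g : GL σ k)
    (f : MvPolynomial σ k) : linSubstAlgEquiv g f = linSubst σ k (g : Matrix σ σ k) f := rfl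

/-- Every element of the orbit `GL_{n²} · det_n` is a prime polynomial (`n ≥ 1`): `det_n` is
prime (`detPoly_prime`) and renaming / invertible substitution are ring automorphisms.
[cite: LandsbergManivelRessayre2013, §3.1 ("The hypersurface in `ℙW` defined by the determinant",
irreducible, p. 475)] -/
theorem prime_linSubst_detFormLex [NeZero n] (g : GL (MatIdx n) ℂ) :
    Prime (linSubst (MatIdx n) ℂ (g : Matrix (MatIdx n) (MatIdx n) ℂ) (detFormLex ℂ n)) := by
  haveI : Nonempty (Fin n) := ⟨⟨0, Nat.pos_of_ne_zero (NeZero.ne n)⟩⟩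
  have h1 : Prime (detFormLex ℂ n) := by
    rw [detFormLex, show rename toLex (detPoly (Fin n) ℂ) =
      renameEquiv ℂ (toLex : Fin n × Fin n ≃ MatIdx n) (detPoly (Fin n) ℂ) from rfl]
    exact (MulEquiv.prime_iff (renameEquiv ℂ (toLex : Fin n × Fin n ≃ MatIdx n))).mpr
      detPoly_prime
  rw [← linSubstAlgEquiv_apply]
  exact (MulEquiv.prime_iff (linSubstAlgEquiv g)).mpr h1

/-- **The dual of the determinant hypersurface is degenerate, in divisibility form** (LMR 2013
§2.1 "Equivalently (assuming `P` is irreducible), for any such subspace `F`, the polynomial `P`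
must divide `det(H_P|_F)`" + §3.1): for `P ∈ GL_{n²} · det_n` and ANY `(2n+1) × n²` matrices
`U, V`, `P` divides the generalised `(2n+1)`-minor `det(U · H_P · Vᵀ)` — at every zero of `P` the
Hessian has rank `≤ 2n` (Mignon–Ressayre; tree `rank_hessianMatrix_le_two_mul_of_isAffineDetRepr`),
so the minor vanishes on `Z(P)`, and `P` is prime (Nullstellensatz).
[cite: LandsbergManivelRessayre2013, §2.1 + §3.1 (Segre's formula: `dim Z(det_n)^∨ = 2n − 2`, so
`det_n ∣ det(H|_F)` for every `(2n+1)`-plane `F`)] -/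
theorem linSubst_detFormLex_dvd_hessGenMinor [NeZero n] (g : GL (MatIdx n) ℂ)
    (U V : Matrix (Fin (2 * n + 1)) (MatIdx n) ℂ) :
    linSubst (MatIdx n) ℂ (g : Matrix (MatIdx n) (MatIdx n) ℂ) (detFormLex ℂ n) ∣
      hessGenMinor U V (linSubst (MatIdx n) ℂ (g : Matrix (MatIdx n) (MatIdx n) ℂ) (detFormLex ℂ n)) := by
  refine dvd_of_prime_of_forall_eval_eq_zero (prime_linSubst_detFormLex g) fun x hx => ?_
  rw [eval_hessGenMinor]
  have hrank := rank_hessianMatrix_le_two_mul_of_isAffineDetRepr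
    (isAffineDetRepr_linSubst_detFormLex (n := n) (g : Matrix (MatIdx n) (MatIdx n) ℂ)) x hx
  rw [Fintype.card_fin] at hrank
  exact det_mul_mul_transpose_eq_zero_of_rank_le hrank U V

/-- LMR's `M = e − d + 1` for `det_n`: `e = (2n+1)(n−2)` (degree of `det(H|_F)`), `d = n`.
[cite: LandsbergManivelRessayre2013, §2.3 (`e = (k+3)(d−2)`, `b = e − d + 1`) with §3.1 (`k = 2n−2`,
`d = n`)] -/
def lmrDegM (n : ℕ) : ℕ := (2 * n + 1) * (n - 2) - n + 1

/-- **Orbit side.** For `n ≥ 3`, any coordinate flag `f : Fin (2n+1) → MatIdx n` (`2n − 1 + 2`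
coordinates) and every `P ∈ GL_{n²} · det_n`: `E(P) = 0`.
[cite: LandsbergManivelRessayre2013, Thm. 2.3.1 (p. 474) applied via Thm. 3.1.1 / §3.2 (p. 476):
`[det_n] ∈ Dual_{2n−2,n,n²}`] -/
theorem lmrEq_eq_zero_of_mem_glOrbit_detFormLex (hn : 3 ≤ n) (f : Fin (2 * n - 1 + 2) → MatIdx n)
    {P : MvPolynomial (MatIdx n) ℂ} (hP : P ∈ glOrbit (MatIdx n) ℂ (detFormLex ℂ n)) :
    lmrEq f (lmrDegM n) P = 0 := by
  haveI : NeZero n := ⟨by omega⟩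
  obtain ⟨g, rfl⟩ := hP
  change lmrEq f (lmrDegM n)
    (linSubst (MatIdx n) ℂ (g : Matrix (MatIdx n) (MatIdx n) ℂ) (detFormLex ℂ n)) = 0
  set P := linSubst (MatIdx n) ℂ (g : Matrix (MatIdx n) (MatIdx n) ℂ) (detFormLex ℂ n) with hPdef
  have h2n : 2 * n - 1 + 2 = 2 * n + 1 := by omega
  -- the minor with the selection matrices of `f`, reindexed to `Fin (2n+1)`
  obtain ⟨D, hD⟩ : P ∣ hessGenMinor (selMatrix f) (selMatrix f) P := by
    have key := linSubst_detFormLex_dvd_hessGenMinor (n := n) g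
      ((selMatrix (A := ℂ) f).submatrix (Fin.cast h2n.symm) id)
      ((selMatrix (A := ℂ) f).submatrix (Fin.cast h2n.symm) id)
    have hre : hessGenMinor ((selMatrix (A := ℂ) f).submatrix (Fin.cast h2n.symm) id)
        ((selMatrix (A := ℂ) f).submatrix (Fin.cast h2n.symm) id) P =
        hessGenMinor (selMatrix f) (selMatrix f) P := by
      unfold hessGenMinor
      rw [← Matrix.det_submatrix_equiv_self (finCongr h2n.symm)]
      congr 1
    rwa [hre] at key
  have hPhom : P.IsHomogeneous n := by
    rw [hPdef]
    exact linSubst_isHomogeneous _ (detFormLex_isHomogeneous ℂ n)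
  have hP0 : P ≠ 0 := (prime_linSubst_detFormLex g).ne_zero
  refine lmrEq_eq_zero_of_eq_mul f (lmrDegM n) hD ?_
  refine (natDegree_lineRestr_le _ _ D).trans_lt ?_
  by_cases hD0 : D = 0
  · rw [hD0, totalDegree_zero, lmrDegM]
    omega
  have hdeg := totalDegree_hessGenMinor_le_of_isHomogeneous (selMatrix (A := ℂ) f)
    (selMatrix f) hPhom
  rw [hD, totalDegree_mul_of_isDomain hP0 hD0, hPhom.totalDegree hP0] at hdeg
  rw [lmrDegM]
  have h3 : (2 * n - 1 + 2) * (n - 2) = (2 * n + 1) * (n - 2) := by rw [h2n]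
  rw [h3] at hdeg
  omega

end OrbitSide

/-! ### §5 Homogeneity from the scaling law -/

section Homogeneity

variable {τ k : Type*} [Field k] [Infinite k]

/-- A polynomial whose values scale like `F(t v) = t^D F(v)` is homogeneous of degree `D`
(infinite field).
[cite: LandsbergManivelRessayre2013, §2.2, eq. (3) (homogeneity read off from the rescaling
behaviour)] -/
theorem isHomogeneous_of_eval_smul [Fintype τ] {F : MvPolynomial τ k} {D : ℕ}
    (h : ∀ (t : k) (v : τ → k), MvPolynomial.eval (t • v) F = t ^ D * MvPolynomial.eval v F) :
    F.IsHomogeneous D := by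
  classical
  set N := F.totalDegree + D + 1 with hN
  have hvanish : ∀ i, N ≤ i → homogeneousComponent i F = 0 := fun i hi =>
    homogeneousComponent_eq_zero _ _ (by rw [hN] at hi; omega)
  have hsumN : ∑ i ∈ Finset.range N, homogeneousComponent i F = F := by
    rw [hN, show F.totalDegree + D + 1 = (F.totalDegree + 1) + D by ring,
      Finset.sum_range_add, sum_homogeneousComponent]
    conv_rhs => rw [← add_zero F]
    congr 1
    exact Finset.sum_eq_zero fun i _ => homogeneousComponent_eq_zero _ _ (by omega)
  have hDN : D < N := by rw [hN]; omega
  -- every other homogeneous component vanishes identically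
  have hcomp : ∀ j, j ≠ D → homogeneousComponent j F = 0 := by
    intro j hj
    by_cases hjN : N ≤ j
    · exact hvanish j hjN
    rw [not_le] at hjN
    apply MvPolynomial.funext
    intro v
    rw [map_zero]
    -- the univariate polynomial `t ↦ Σ_i t^i F_i(v) − t^D F(v)` vanishes identically
    let φ : k[X] := ∑ i ∈ Finset.range N,
        Polynomial.C (MvPolynomial.eval v (homogeneousComponent i F)) * Polynomial.X ^ i -
      Polynomial.C (MvPolynomial.eval v F) * Polynomial.X ^ D
    have hφ : ∀ t : k, φ.IsRoot t := by
      intro t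
      have hsum : ∑ i ∈ Finset.range N, MvPolynomial.eval (t • v) (homogeneousComponent i F) =
          MvPolynomial.eval (t • v) F := by
        rw [← map_sum, hsumN]
      simp only [φ, Polynomial.IsRoot, Polynomial.eval_sub, Polynomial.eval_finsetSum,
        Polynomial.eval_mul, Polynomial.eval_C, Polynomial.eval_pow, Polynomial.eval_X]
      rw [mul_comm _ (t ^ D), ← h t v, ← hsum]
      refine sub_eq_zero.mpr (Finset.sum_congr rfl fun i _ => ?_)
      rw [eval_smul_of_isHomogeneous (homogeneousComponent_isHomogeneous i F), mul_comm]
    have hφ0 : φ = 0 := by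
      refine Polynomial.eq_zero_of_infinite_isRoot φ ?_
      rw [show {x | φ.IsRoot x} = Set.univ from Set.eq_univ_of_forall hφ]
      exact Set.infinite_univ
    have hcoeff := congrArg (fun ψ : k[X] => ψ.coeff j) hφ0
    simp only [φ, Polynomial.coeff_sub, Polynomial.finsetSum_coeff, Polynomial.coeff_C_mul,
      Polynomial.coeff_X_pow, Polynomial.coeff_zero] at hcoeff
    rw [Finset.sum_eq_single j, if_pos rfl, mul_one, if_neg hj, mul_zero, sub_zero] at hcoeff
    · exact hcoeff
    · intro i _ hij
      rw [if_neg (Ne.symm hij), mul_zero]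
    · intro hjN'
      exact absurd (Finset.mem_range.mpr hjN) hjN'
  -- hence `F` is its degree-`D` component
  have hF : F = homogeneousComponent D F := by
    conv_lhs => rw [← hsumN]
    rw [Finset.sum_eq_single D]
    · intro i _ hi
      exact hcomp i hi
    · intro hD
      exact absurd (Finset.mem_range.mpr hDN) hD
  rw [hF]
  exact homogeneousComponent_isHomogeneous D F

end Homogeneity

/-! ### §6 `E` as an element of the coordinate ring `k[Sym^m(k^σ)]` -/

section Coord

variable {σ : Type*} [Fintype σ] [DecidableEq σ] {k : Type*} [Field k] {r : ℕ}

variable (σ k) in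
/-- The generic form of degree `m` with the COORDINATE FUNCTIONS of `Sym^m` as coefficients:
`∑_{|δ| = m} X_δ · x^δ ∈ (k[Sym^m])[x]`.
[cite: LandsbergManivelRessayre2013, §2.2 ("considered as a polynomial equation in the coefficients
of `P`")] -/
def genericFormDeg (m : ℕ) : MvPolynomial σ (MvPolynomial (DegIdx σ m) k) :=
  ∑ δ : DegIdx σ m, monomial δ.1 (X δ)

/-- Specialising the coordinate functions at the coefficient vector of a form `h` of degree `m`
gives back `h`. [cite: LandsbergManivelRessayre2013, §2.2] -/
theorem map_eval_formCoeff_genericFormDeg {m : ℕ} {h : MvPolynomial σ k} (hh : h.IsHomogeneous m) :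
    MvPolynomial.map (MvPolynomial.eval (formCoeff m h)) (genericFormDeg σ k m) = h := by
  rw [genericFormDeg, map_sum]
  simp only [MvPolynomial.map_monomial, MvPolynomial.eval_X, formCoeff_apply]
  conv_rhs => rw [← sum_coeff_smul_monomial_eq hh]
  refine Finset.sum_congr rfl fun δ _ => ?_
  rw [MvPolynomial.smul_monomial, smul_eq_mul, mul_one]

/-- Specialising at an arbitrary point `v` of `Sym^m` gives the form `∑_δ v_δ x^δ`.
[cite: LandsbergManivelRessayre2013, §2.2] -/
theorem map_eval_genericFormDeg {m : ℕ} (v : DegIdx σ m → k) :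
    MvPolynomial.map (MvPolynomial.eval v) (genericFormDeg σ k m) =
      ∑ δ : DegIdx σ m, monomial δ.1 (v δ) := by
  rw [genericFormDeg, map_sum]
  simp only [MvPolynomial.map_monomial, MvPolynomial.eval_X]

/-- **`E` as a polynomial function on `Sym^m(k^σ)`**: LMR's equation as an element of the
coordinate ring `coordRep σ k m = k[Sym^m]`.
[cite: LandsbergManivelRessayre2013, §2.3 ("a highest weight vector in some module of polynomials on
`S^n W^*`", p. 473)] -/
def lmrEqCoord (f : Fin (r + 2) → σ) (M m : ℕ) : MvPolynomial (DegIdx σ m) k :=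
  lmrEq f M (genericFormDeg σ k m)

/-- Its value at a form `h` of degree `m` is `E(h)`. [cite: LandsbergManivelRessayre2013, §2.3] -/
theorem aeval_formCoeff_lmrEqCoord (f : Fin (r + 2) → σ) (M : ℕ) {m : ℕ} {h : MvPolynomial σ k}
    (hh : h.IsHomogeneous m) :
    aeval (formCoeff m h) (lmrEqCoord (k := k) f M m) = lmrEq f M h := by
  rw [show aeval (formCoeff m h) (lmrEqCoord (k := k) f M m) =
      MvPolynomial.eval (formCoeff m h) (lmrEqCoord (k := k) f M m) from rfl,
    lmrEqCoord, map_lmrEq, map_eval_formCoeff_genericFormDeg hh]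

/-- Its value at a point `v` is `E(∑_δ v_δ x^δ)`. [cite: LandsbergManivelRessayre2013, §2.3] -/
theorem eval_lmrEqCoord (f : Fin (r + 2) → σ) (M : ℕ) {m : ℕ} (v : DegIdx σ m → k) :
    MvPolynomial.eval v (lmrEqCoord (k := k) f M m) = lmrEq f M (∑ δ : DegIdx σ m, monomial δ.1 (v δ)) := by
  rw [lmrEqCoord, map_lmrEq, map_eval_genericFormDeg]

/-- **`E` is homogeneous of degree `(r + 2) + M`** in the coordinates of `Sym^m` (infinite field).
[cite: LandsbergManivelRessayre2013, Thm. 2.3.1 ("These equations have degree `(k+2)(d−1)`", p.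
474)] -/
theorem lmrEqCoord_isHomogeneous [Infinite k] (f : Fin (r + 2) → σ) (M m : ℕ) :
    (lmrEqCoord (k := k) f M m).IsHomogeneous (r + 2 + M) := by
  refine isHomogeneous_of_eval_smul fun t v => ?_
  rw [eval_lmrEqCoord, eval_lmrEqCoord]
  have hsum : (∑ δ : DegIdx σ m, monomial δ.1 ((t • v) δ) : MvPolynomial σ k) =
      MvPolynomial.C t * ∑ δ : DegIdx σ m, monomial δ.1 (v δ) := by
    rw [Finset.mul_sum]
    refine Finset.sum_congr rfl fun δ _ => ?_
    rw [Pi.smul_apply, smul_eq_mul, MvPolynomial.C_mul_monomial]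
  rw [hsum, lmrEq_C_mul, ← pow_add]

/-- **`E` lies in the ideal of an orbit** as soon as it vanishes on the orbit.
[cite: LandsbergManivelRessayre2013, §3.2 ("is in the ideal of `\\overline{GL(W)·[det_n]}`", p.
476)] -/
theorem lmrEqCoord_mem_orbitVanishingIdeal (f : Fin (r + 2) → σ) (M : ℕ) {m : ℕ}
    {g₀ : MvPolynomial σ k} (hg₀ : g₀.IsHomogeneous m)
    (h0 : ∀ P ∈ glOrbit σ k g₀, lmrEq f M P = 0) :
    lmrEqCoord (k := k) f M m ∈ orbitVanishingIdeal g₀ m := by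
  rw [mem_orbitVanishingIdeal_iff]
  intro g
  have hhom : (linSubstRep σ k g g₀).IsHomogeneous m := by
    rw [linSubstRep_apply]
    exact linSubst_isHomogeneous _ hg₀
  rw [aeval_formCoeff_lmrEqCoord f M hhom]
  exact h0 _ ⟨g, rfl⟩

/-- **`E` is nonzero** as soon as it does not vanish at one form of degree `m`.
[cite: LandsbergManivelRessayre2013, §2.3] -/
theorem lmrEqCoord_ne_zero (f : Fin (r + 2) → σ) (M : ℕ) {m : ℕ} {h : MvPolynomial σ k}
    (hh : h.IsHomogeneous m) (hE : lmrEq f M h ≠ 0) : lmrEqCoord (k := k) f M m ≠ 0 := by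
  intro hzero
  apply hE
  rw [← aeval_formCoeff_lmrEqCoord f M hh, hzero, map_zero]

end Coord

/-! ### §7 The theorem modulo a witness, for `det_n` -/

section DetAssembly

open _root_.Literature.NumberTheory.DiophantineGeometry

variable {n : ℕ}

/-- **`I(Δ(det_n))_{2n(n−1)} ≠ 0`, given one form on which `E` does not vanish.** For `n ≥ 3`,
a coordinate flag `f` and a form `h` of degree `n` with `E(h) ≠ 0`: the ideal of
`GL_{n²} · det_n` contains a nonzero HIGHEST-WEIGHT vector of `ℂ[Sym^n(ℂ^{n²})]`, homogeneous of
degree `2n(n−1)` (LMR 2013 Thm. 1.1.2 (1): the degree statement).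
[cite: LandsbergManivelRessayre2013, Thm. 1.1.2 (1) (p. 470) with §3.2 (p. 476)] -/
theorem exists_hwv_idealDet_of_witness (hn : 3 ≤ n) (f : Fin (2 * n - 1 + 2) → MatIdx n)
    {h : MvPolynomial (MatIdx n) ℂ} (hh : h.IsHomogeneous n)
    (hE : lmrEq f (lmrDegM n) h ≠ 0) :
    ∃ (χ : Weight (MatIdx n)) (F : MvPolynomial (DegIdx (MatIdx n) n) ℂ),
      F ∈ highestWeightSpace (coordRep (MatIdx n) ℂ n) χ ∧
        F ∈ orbitVanishingIdeal (detFormLex ℂ n) n ∧ F ≠ 0 ∧ F.IsHomogeneous (2 * n * (n - 1)) := by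
  haveI : Infinite ℂ := CharZero.infinite ℂ
  have hmem := lmrEqCoord_mem_orbitVanishingIdeal (k := ℂ) f (lmrDegM n)
    (detFormLex_isHomogeneous ℂ n) (fun P hP => lmrEq_eq_zero_of_mem_glOrbit_detFormLex hn f hP)
  have hne := lmrEqCoord_ne_zero (k := ℂ) f (lmrDegM n) hh hE
  have hhom := lmrEqCoord_isHomogeneous (k := ℂ) f (lmrDegM n) n
  have hdeg : 2 * n - 1 + 2 + lmrDegM n = 2 * n * (n - 1) := by
    rw [lmrDegM]
    obtain ⟨j, rfl⟩ := Nat.exists_eq_add_of_le' hn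
    have h1 : 2 * (j + 3) - 1 = 2 * j + 5 := by omega
    have h2 : j + 3 - 2 = j + 1 := by omega
    have h3 : j + 3 - 1 = j + 2 := by omega
    rw [h1, h2, h3]
    have h4 : j + 3 ≤ (2 * (j + 3) + 1) * (j + 1) := by nlinarith
    zify [h4]
    ring
  rw [hdeg] at hhom
  exact exists_hwv_of_mem_orbitVanishingIdeal hmem hne hhom

end DetAssembly

/-! ### §8 Plane restrictions and Hessian minors in coordinates (towards the test form) -/

section WitnessLemmas

variable {A : Type*} [CommRing A] {ι : Type*} [Fintype ι] [DecidableEq ι]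

omit [Fintype ι] in
/-- The plane restriction on a variable.
[cite: LandsbergManivelRessayre2013, §2.2 (`P_L(1, y)` in coordinates)] -/
theorem planeRestr_X (x y i : ι) :
    planeRestr (A := A) x y (X i) =
      Polynomial.C (Pi.single (M := fun _ => A) x 1 i) +
        Polynomial.C (Pi.single (M := fun _ => A) y 1 i) * Polynomial.X :=
  lineRestr_X _ _ i

/-- **The plane restriction of a monomial**: `x^a y^b ↦ Y^b`, and `0` as soon as another
variable occurs. [cite: LandsbergManivelRessayre2013, §2.2 (`P_L(1, y)` in coordinates)] -/
theorem planeRestr_monomial {x y : ι} (hxy : x ≠ y) (β : ι →₀ ℕ) (c : A) :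
    planeRestr (A := A) x y (MvPolynomial.monomial β c) =
      if ∀ i, i ≠ x → i ≠ y → β i = 0 then Polynomial.C c * Polynomial.X ^ (β y) else 0 := by
  classical
  have hdef : planeRestr (A := A) x y (MvPolynomial.monomial β c) =
      Polynomial.C c * β.prod fun i e =>
        (Polynomial.C (Pi.single (M := fun _ => A) x 1 i) +
          Polynomial.C (Pi.single (M := fun _ => A) y 1 i) * Polynomial.X) ^ e := by
    rw [planeRestr, lineRestr, MvPolynomial.aeval_monomial, Polynomial.algebraMap_eq]
  rw [hdef]
  have hgx : Polynomial.C (Pi.single (M := fun _ => A) x 1 x) +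
      Polynomial.C (Pi.single (M := fun _ => A) y 1 x) * Polynomial.X = 1 := by
    rw [Pi.single_eq_same, Pi.single_eq_of_ne hxy]; simp
  have hgy : Polynomial.C (Pi.single (M := fun _ => A) x 1 y) +
      Polynomial.C (Pi.single (M := fun _ => A) y 1 y) * Polynomial.X = Polynomial.X := by
    rw [Pi.single_eq_same, Pi.single_eq_of_ne (Ne.symm hxy)]; simp
  have hgz : ∀ i, i ≠ x → i ≠ y → Polynomial.C (Pi.single (M := fun _ => A) x 1 i) +
      Polynomial.C (Pi.single (M := fun _ => A) y 1 i) * Polynomial.X = 0 := by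
    intro i hix hiy
    rw [Pi.single_eq_of_ne hix, Pi.single_eq_of_ne hiy]; simp
  split_ifs with hcond
  · have hsub : β.support ⊆ {x, y} := by
      intro i hi
      rw [Finset.mem_insert, Finset.mem_singleton]
      by_contra h
      rw [not_or] at h
      exact (Finsupp.mem_support_iff.mp hi) (hcond i h.1 h.2)
    rw [Finsupp.prod_of_support_subset β hsub _ (fun i _ => pow_zero _),
      Finset.prod_pair hxy, hgx, hgy, one_pow, one_mul]
  · simp only [not_forall] at hcond
    obtain ⟨i, hix, hiy, hi⟩ := hcond
    rw [Finsupp.prod, Finset.prod_eq_zero (Finsupp.mem_support_iff.mpr hi), mul_zero]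
    rw [hgz i hix hiy, zero_pow hi]

omit [Fintype ι] [DecidableEq ι] in
/-- Second partial derivatives of a monomial.
[cite: LandsbergManivelRessayre2013, §2.1 ("the symmetric matrix of second partial derivatives of
`P`")] -/
theorem pderiv_pderiv_monomial (u v : ι) (α : ι →₀ ℕ) (c : A) :
    pderiv u (pderiv v (MvPolynomial.monomial α c)) =
      MvPolynomial.monomial (α - Finsupp.single v 1 - Finsupp.single u 1)
        (c * (α v : A) * (((α - Finsupp.single v 1 : ι →₀ ℕ) u : ℕ) : A)) := by
  rw [pderiv_monomial, pderiv_monomial]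

/-- **Pure powers**: for `s ∈ {x, y}`, `ρ(∂_u ∂_v x_s^n) = [u = v = s] · n(n−1) · ρ(x_s)^{n−2}`.
[cite: LandsbergManivelRessayre2013, §2.1–2.2 (entries of `H_P|_F` restricted to `L`)] -/
theorem planeRestr_pderiv_pderiv_X_pow {x y : ι} (hxy : x ≠ y) {s : ι} (hs : s = x ∨ s = y)
    (u v : ι) (n : ℕ) :
    planeRestr (A := A) x y
        (pderiv u (pderiv v (MvPolynomial.monomial (Finsupp.single s n) (1 : A)))) =
      if u = s ∧ v = s then
        Polynomial.C ((n : A) * ((n - 1 : ℕ) : A)) *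
          Polynomial.X ^ ((Finsupp.single s (n - 2) : ι →₀ ℕ) y)
      else 0 := by
  classical
  rw [pderiv_pderiv_monomial]
  by_cases huv : u = s ∧ v = s
  · obtain ⟨hu, hv⟩ := huv
    rw [hu, hv]
    have hα : (Finsupp.single s n - Finsupp.single s 1 - Finsupp.single s 1 : ι →₀ ℕ) =
        Finsupp.single s (n - 2) := by
      ext i
      simp only [Finsupp.coe_tsub, Pi.sub_apply, Finsupp.single_apply]
      split_ifs <;> omega
    have hc : (1 : A) * ((Finsupp.single s n : ι →₀ ℕ) s : ℕ) *
        (((Finsupp.single s n - Finsupp.single s 1 : ι →₀ ℕ) s : ℕ) : A) =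
        (n : A) * ((n - 1 : ℕ) : A) := by
      simp only [Finsupp.coe_tsub, Pi.sub_apply, Finsupp.single_eq_same, one_mul]
    rw [hα, hc, planeRestr_monomial hxy, if_pos, if_pos ⟨rfl, rfl⟩]
    intro i hix hiy
    rw [Finsupp.single_apply, if_neg]
    rintro rfl
    rcases hs with h | h
    · exact hix h
    · exact hiy h
  · rw [if_neg huv]
    have hc : (1 : A) * ((Finsupp.single s n : ι →₀ ℕ) v : ℕ) *
        (((Finsupp.single s n - Finsupp.single v 1 : ι →₀ ℕ) u : ℕ) : A) = 0 := by
      by_cases hv : v = s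
      · subst hv
        have hu : u ≠ v := fun h => huv ⟨h, rfl⟩
        have : ((Finsupp.single v n - Finsupp.single v 1 : ι →₀ ℕ) u : ℕ) = 0 := by
          simp only [Finsupp.coe_tsub, Pi.sub_apply, Finsupp.single_apply, if_neg (Ne.symm hu),
            tsub_zero]
        rw [this, Nat.cast_zero, mul_zero]
      · have : ((Finsupp.single s n : ι →₀ ℕ) v : ℕ) = 0 := by
          rw [Finsupp.single_apply, if_neg (Ne.symm hv)]
        rw [this, Nat.cast_zero, mul_zero, zero_mul]
    rw [hc, MvPolynomial.monomial_zero, map_zero]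

/-- **Square of an extra variable times a plane monomial**: for `z ∉ {x, y}` and `γ` supported in
`{x, y}`, `ρ(∂_u ∂_v (z² x^{γ_x} y^{γ_y})) = [u = v = z] · 2 Y^{γ_y}`.
[cite: LandsbergManivelRessayre2013, §2.1–2.2 (entries of `H_P|_F` restricted to `L`)] -/
theorem planeRestr_pderiv_pderiv_sq_mul {x y z : ι} (hxy : x ≠ y) (hzx : z ≠ x) (hzy : z ≠ y)
    {γ : ι →₀ ℕ} (hγ : ∀ i, i ≠ x → i ≠ y → γ i = 0) (u v : ι) :
    planeRestr (A := A) x y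
        (pderiv u (pderiv v (MvPolynomial.monomial (Finsupp.single z 2 + γ) (1 : A)))) =
      if u = z ∧ v = z then Polynomial.C (2 : A) * Polynomial.X ^ (γ y) else 0 := by
  classical
  have hγz : γ z = 0 := hγ z hzx hzy
  rw [pderiv_pderiv_monomial, planeRestr_monomial hxy]
  by_cases huv : u = z ∧ v = z
  · obtain ⟨hu, hv⟩ := huv
    rw [hu, hv]
    have hα : (Finsupp.single z 2 + γ - Finsupp.single z 1 - Finsupp.single z 1 : ι →₀ ℕ) = γ := by
      ext i
      simp only [Finsupp.coe_tsub, Finsupp.coe_add, Pi.sub_apply, Pi.add_apply,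
        Finsupp.single_apply]
      split_ifs with h
      · subst h; omega
      · omega
    have hc : (1 : A) * ((Finsupp.single z 2 + γ : ι →₀ ℕ) z : ℕ) *
        (((Finsupp.single z 2 + γ - Finsupp.single z 1 : ι →₀ ℕ) z : ℕ) : A) = 2 := by
      simp only [Finsupp.coe_tsub, Finsupp.coe_add, Pi.sub_apply, Pi.add_apply,
        Finsupp.single_eq_same, hγz]
      norm_num
    rw [hα, hc, if_pos hγ, if_pos ⟨rfl, rfl⟩]
  · rw [if_neg huv, if_neg]
    intro hcond
    have hz := hcond z hzx hzy
    simp only [Finsupp.coe_tsub, Finsupp.coe_add, Pi.sub_apply, Pi.add_apply,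
      Finsupp.single_eq_same, Finsupp.single_apply] at hz
    by_cases hu : u = z <;> by_cases hv : v = z <;> simp_all

/-- Conjugating by the selection matrix extracts the submatrix on the chosen coordinates.
[cite: LandsbergManivelRessayre2013, §2.1 (`H_P|_F`)] -/
theorem selMatrix_mul_mul_transpose {r : ℕ} (f : Fin r → ι) (H : Matrix ι ι A) :
    selMatrix (A := A) f * H * (selMatrix (A := A) f)ᵀ = Matrix.of fun a b => H (f a) (f b) := by
  ext a b
  simp [Matrix.mul_apply, selMatrix, Matrix.of_apply, Matrix.transpose_apply, ite_mul, mul_ite,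
    Finset.sum_ite_eq']

/-- The generalised minor of a coordinate family is the principal minor of the polynomial Hessian
on those coordinates. [cite: LandsbergManivelRessayre2013, §2.1 (`det(H_P|_F)`)] -/
theorem hessGenMinor_selMatrix {r : ℕ} (f : Fin r → ι) (P : MvPolynomial ι A) :
    hessGenMinor (selMatrix f) (selMatrix f) P =
      (Matrix.of fun a b => pderiv (f a) (pderiv (f b) P)).det := by
  rw [hessGenMinor, selMatrix_map, selMatrix_mul_mul_transpose]
  rfl

/-- The plane restriction of that minor is the determinant of the matrix of restricted second
partials `(ρ(∂_{f a} ∂_{f b} P))_{a,b}`.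
[cite: LandsbergManivelRessayre2013, §2.2–2.3 (`Q_L` for `Q = det(H_P|_F)`)] -/
theorem planeRestr_hessGenMinor_selMatrix {r : ℕ} (f : Fin r → ι) (x y : ι)
    (P : MvPolynomial ι A) :
    planeRestr (A := A) x y (hessGenMinor (selMatrix f) (selMatrix f) P) =
      (Matrix.of fun a b => planeRestr (A := A) x y (pderiv (f a) (pderiv (f b) P))).det := by
  rw [hessGenMinor_selMatrix, AlgHom.map_det]
  rfl

end WitnessLemmas

/-! ### §9 The witness form and the value of `E` on it -/

section Witness

variable {k : Type*} [Field k] {ι : Type*} [Fintype ι] [DecidableEq ι] {n : ℕ}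

/-- The exponent of the `c`-th correction term of the witness: `x^{n−3} y` for `c = 0`,
`x^{n−2}` otherwise.
[cite: LandsbergManivelRessayre2013, §2.3 (test form for the equation of the flag; the form itself
is ours)] -/
def witnessGamma (n : ℕ) (x y : ι) (c : Fin (2 * n - 1)) : ι →₀ ℕ :=
  if (c : ℕ) = 0 then Finsupp.single x (n - 3) + Finsupp.single y 1 else Finsupp.single x (n - 2)

/-- **The witness form** `W_n = x^n + y^n + z_0² x^{n−3} y + Σ_{c ≥ 1} z_c² x^{n−2}`, a form of
degree `n` in the `2n + 1` flag variables `x, y, z_0, …, z_{2n−2}`.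
[cite: LandsbergManivelRessayre2013, §2.3 (test form for the equation of the flag; the form itself
is ours)] -/
def lmrWitness (n : ℕ) (x y : ι) (z : Fin (2 * n - 1) → ι) : MvPolynomial ι k :=
  MvPolynomial.monomial (Finsupp.single x n) 1 + MvPolynomial.monomial (Finsupp.single y n) 1 +
    ∑ c : Fin (2 * n - 1), MvPolynomial.monomial (Finsupp.single (z c) 2 + witnessGamma n x y c) 1

omit [Fintype ι] [DecidableEq ι] in
/-- The correction exponents are supported in `{x, y}`. [cite: LandsbergManivelRessayre2013, §2.3
(test form, ours)] -/
theorem witnessGamma_apply_of_ne {x y : ι} (c : Fin (2 * n - 1)) {i : ι} (hix : i ≠ x) (hiy : i ≠ y) :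
    witnessGamma n x y c i = 0 := by
  unfold witnessGamma
  split_ifs <;> simp [Ne.symm hix, Ne.symm hiy]

omit [Fintype ι] [DecidableEq ι] in
/-- The `y`-exponent of the `c`-th correction term: `1` for `c = 0`, else `0`. [cite:
LandsbergManivelRessayre2013, §2.3 (test form, ours)] -/
theorem witnessGamma_apply_y {x y : ι} (hxy : x ≠ y) (c : Fin (2 * n - 1)) :
    witnessGamma n x y c y = if (c : ℕ) = 0 then 1 else 0 := by
  unfold witnessGamma
  split_ifs <;> simp [hxy]

omit [Fintype ι] [DecidableEq ι] in
/-- Each correction exponent has degree `n − 2`. [cite: LandsbergManivelRessayre2013, §2.3 (test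
form, ours)] -/
theorem degree_witnessGamma (hn : 3 ≤ n) (x y : ι) (c : Fin (2 * n - 1)) :
    (witnessGamma n x y c).degree = n - 2 := by
  unfold witnessGamma
  split_ifs
  · rw [map_add, Finsupp.degree_single, Finsupp.degree_single]; omega
  · rw [Finsupp.degree_single]

omit [Fintype ι] [DecidableEq ι] in
/-- The witness is a form of degree `n` (`n ≥ 3`).
[cite: LandsbergManivelRessayre2013, §2.3 (test form, ours)] -/
theorem lmrWitness_isHomogeneous (hn : 3 ≤ n) (x y : ι) (z : Fin (2 * n - 1) → ι) :
    (lmrWitness (k := k) n x y z).IsHomogeneous n := by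
  unfold lmrWitness
  refine ((isHomogeneous_monomial _ ?_).add (isHomogeneous_monomial _ ?_)).add
    (IsHomogeneous.sum _ _ _ fun c _ => isHomogeneous_monomial _ ?_)
  · rw [Finsupp.degree_single]
  · rw [Finsupp.degree_single]
  · rw [map_add, Finsupp.degree_single, degree_witnessGamma hn]; omega

variable {x y : ι} {z : Fin (2 * n - 1) → ι}

/-- Plane restriction of the witness: `W_n(e_x + Y e_y) = 1 + Y^n`.
[cite: LandsbergManivelRessayre2013, §2.2 (`P_L(1, y)` of the test form)] -/
theorem planeRestr_lmrWitness (hxy : x ≠ y) (hzx : ∀ c, z c ≠ x) (hzy : ∀ c, z c ≠ y) :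
    planeRestr (A := k) x y (lmrWitness (k := k) n x y z) = 1 + Polynomial.X ^ n := by
  unfold lmrWitness
  rw [map_add, map_add, map_sum, planeRestr_monomial hxy, planeRestr_monomial hxy, if_pos, if_pos]
  · rw [Finset.sum_eq_zero]
    · simp [Ne.symm hxy]
    · intro c _
      rw [planeRestr_monomial hxy, if_neg]
      intro h
      have := h (z c) (hzx c) (hzy c)
      simp [witnessGamma_apply_of_ne c (hzx c) (hzy c)] at this
  · intro i hix hiy; simp [Ne.symm hiy]
  · intro i hix hiy; simp [Ne.symm hix]

/-- The diagonal of the restricted Hessian of the witness on the flag variables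
`(x, y, z_0, …)`. [cite: LandsbergManivelRessayre2013, §2.1 (`H_P|_F` of the test form)] -/
def witnessDiag (n : ℕ) : Fin (2 * n - 1 + 2) → k[X] :=
  Fin.cons (Polynomial.C ((n : k) * ((n - 1 : ℕ) : k)))
    (Fin.cons (Polynomial.C ((n : k) * ((n - 1 : ℕ) : k)) * Polynomial.X ^ (n - 2))
      fun c => Polynomial.C (2 : k) * Polynomial.X ^ (if (c : ℕ) = 0 then 1 else 0))

/-- **The restricted Hessian of the witness on the flag is diagonal.**
[cite: LandsbergManivelRessayre2013, §2.1–2.2 (`(H_P|_F)_L` of the test form)] -/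
theorem planeRestr_pderiv_pderiv_lmrWitness (hinj : Function.Injective
      (Fin.cons x (Fin.cons y z : Fin (2 * n - 1 + 1) → ι) : Fin (2 * n - 1 + 2) → ι))
    (a b : Fin (2 * n - 1 + 2)) :
    planeRestr (A := k) x y (pderiv ((Fin.cons x (Fin.cons y z : Fin (2 * n - 1 + 1) → ι) :
        Fin (2 * n - 1 + 2) → ι) a) (pderiv ((Fin.cons x (Fin.cons y z :
        Fin (2 * n - 1 + 1) → ι) : Fin (2 * n - 1 + 2) → ι) b) (lmrWitness (k := k) n x y z))) =
      Matrix.diagonal (witnessDiag (k := k) n) a b := by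
  set f : Fin (2 * n - 1 + 2) → ι := Fin.cons x (Fin.cons y z : Fin (2 * n - 1 + 1) → ι) with hf
  have hf0 : f 0 = x := rfl
  have hf1 : f 1 = y := rfl
  have hfz : ∀ c : Fin (2 * n - 1), f c.succ.succ = z c := fun c => rfl
  have hxy : x ≠ y := by
    intro h; have := @hinj 0 1 (by rw [hf0, hf1, h]); exact Fin.zero_ne_one this
  have hzx : ∀ c, z c ≠ x := by
    intro c h; have := @hinj c.succ.succ 0 (by rw [hfz, hf0, h]); exact Fin.succ_ne_zero _ this
  have hzy : ∀ c, z c ≠ y := by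
    intro c h
    have := @hinj c.succ.succ 1 (by rw [hfz, hf1, h])
    exact Fin.succ_ne_zero _ (Fin.succ_injective _ this)
  have hγ : ∀ c i, i ≠ x → i ≠ y → witnessGamma n x y c i = 0 :=
    fun c i hix hiy => witnessGamma_apply_of_ne c hix hiy
  -- expand by linearity
  unfold lmrWitness
  simp only [map_add, map_sum]
  rw [planeRestr_pderiv_pderiv_X_pow hxy (Or.inl rfl), planeRestr_pderiv_pderiv_X_pow hxy (Or.inr rfl)]
  simp only [fun c => planeRestr_pderiv_pderiv_sq_mul (A := k) hxy (hzx c) (hzy c) (hγ c) (f a) (f b)]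
  -- identify `f a = x` etc. with conditions on the indices
  have hax : ∀ a, f a = x ↔ a = 0 := fun a => by
    rw [← hf0]; exact hinj.eq_iff
  have hay : ∀ a, f a = y ↔ a = 1 := fun a => by
    rw [← hf1]; exact hinj.eq_iff
  have haz : ∀ a c, f a = z c ↔ a = c.succ.succ := fun a c => by
    rw [← hfz]; exact hinj.eq_iff
  simp only [hax, hay, haz, witnessGamma_apply_y hxy, Finsupp.single_apply, hxy, if_false, if_true]
  rw [Matrix.diagonal_apply]
  -- the index facts `succ (succ c) ≠ 0, 1` in `iff False` form, for `simp`
  have hs0 : ∀ c : Fin (2 * n - 1), (c.succ.succ = (0 : Fin (2 * n - 1 + 2))) ↔ False :=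
    fun c => ⟨fun h => Fin.succ_ne_zero _ h, False.elim⟩
  have h0s : ∀ c : Fin (2 * n - 1), ((0 : Fin (2 * n - 1 + 2)) = c.succ.succ) ↔ False :=
    fun c => ⟨fun h => Fin.succ_ne_zero _ h.symm, False.elim⟩
  have hs1 : ∀ c : Fin (2 * n - 1), (c.succ.succ = (1 : Fin (2 * n - 1 + 2))) ↔ False :=
    fun c => ⟨fun h => Fin.succ_ne_zero _ (Fin.succ_injective _ h), False.elim⟩
  have h1s : ∀ c : Fin (2 * n - 1), ((1 : Fin (2 * n - 1 + 2)) = c.succ.succ) ↔ False :=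
    fun c => ⟨fun h => Fin.succ_ne_zero _ (Fin.succ_injective _ h.symm), False.elim⟩
  -- case analysis on the two indices
  cases a using Fin.cases with
  | zero =>
    cases b using Fin.cases with
    | zero => simp [witnessDiag, h0s]
    | succ b' => simp [Fin.succ_ne_zero, (Fin.succ_ne_zero _).symm]
  | succ a' =>
    cases a' using Fin.cases with
    | zero =>
      cases b using Fin.cases with
      | zero => simp [h0s, h1s]
      | succ b' =>
        cases b' using Fin.cases with
        | zero => simp [witnessDiag, h1s]
        | succ c => simp [Fin.succ_ne_zero, Fin.succ_inj, hs1, h1s]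
    | succ c =>
      cases b using Fin.cases with
      | zero => simp [Fin.succ_ne_zero, h0s]
      | succ b' =>
        cases b' using Fin.cases with
        | zero => simp [Fin.succ_ne_zero, Fin.succ_inj, hs1, h1s]
        | succ d =>
          by_cases hcd : c = d
          · subst hcd
            simp [witnessDiag, Fin.succ_inj, hs0, hs1]
          · have hcd' : ∀ e : Fin (2 * n - 1), (c = e ∧ d = e) ↔ False :=
              fun e => ⟨fun h => hcd (h.1.trans h.2.symm), False.elim⟩
            simp [Fin.succ_inj, hs0, hs1, hcd, hcd']

/-- `lmrDegM n = n(2n−5) + (n−1)` for `n ≥ 3` (so the only index `i` with `n i + (n−1) = M` is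
`i = 2n − 5`).
[cite: LandsbergManivelRessayre2013, §2.3 + §3.1 (`e − d + 1` at `k = 2n−2`, `d = n`)] -/
theorem lmrDegM_eq (hn : 3 ≤ n) : lmrDegM n = n * (2 * n - 5) + (n - 1) := by
  rw [lmrDegM]
  obtain ⟨j, rfl⟩ := Nat.exists_eq_add_of_le' hn
  have h1 : 2 * (j + 3) - 5 = 2 * j + 1 := by omega
  have h2 : j + 3 - 2 = j + 1 := by omega
  have h3 : j + 3 - 1 = j + 2 := by omega
  rw [h1, h2, h3]
  have h4 : j + 3 ≤ (2 * (j + 3) + 1) * (j + 1) := by nlinarith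
  zify [h4]
  ring

/-- The determinant of the (diagonal) restricted Hessian of the witness:
`n²(n−1)² 2^{2n−1} · Y^{n−1}`.
[cite: LandsbergManivelRessayre2013, §2.3 (`Q_L = det(H_P|_F)_L` of the test form)] -/
theorem det_diagonal_witnessDiag (hn : 3 ≤ n) :
    (Matrix.diagonal (witnessDiag (k := k) n)).det =
      Polynomial.C ((((n : k) * ((n - 1 : ℕ) : k)) ^ 2) * 2 ^ (2 * n - 1)) *
        Polynomial.X ^ (n - 1) := by
  have h0 : 0 < 2 * n - 1 := by omega
  rw [Matrix.det_diagonal, Fin.prod_univ_succ, Fin.prod_univ_succ]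
  simp only [witnessDiag, Fin.cons_zero, Fin.cons_succ]
  rw [Finset.prod_mul_distrib, Finset.prod_const, Finset.card_univ, Fintype.card_fin,
    Finset.prod_pow_eq_pow_sum]
  have hsum : ∑ c : Fin (2 * n - 1), (if (c : ℕ) = 0 then 1 else 0) = 1 := by
    rw [Finset.sum_boole]
    have : (Finset.univ.filter fun c : Fin (2 * n - 1) => (c : ℕ) = 0) = {⟨0, h0⟩} := by
      ext c
      simp [Fin.ext_iff]
    rw [this, Finset.card_singleton]
    rfl
  rw [hsum, pow_one]
  have hX : (Polynomial.X : k[X]) ^ (n - 1) = Polynomial.X ^ (n - 2) * Polynomial.X := by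
    rw [← pow_succ]
    congr 1
    omega
  rw [hX]
  simp only [map_mul, map_pow]
  ring

/-- LMR's remainder functional on the witness data: `R̂_M(1 + Y^n, c Y^{n−1}) = c (−1)^{2n−5}`.
[cite: LandsbergManivelRessayre2013, §2.2, eq. (2) (evaluated)] -/
theorem lmrR_one_add_X_pow (hn : 3 ≤ n) (c : k) :
    lmrR (lmrDegM n) (1 + Polynomial.X ^ n) (Polynomial.C c * Polynomial.X ^ (n - 1)) =
      c * (-1) ^ (2 * n - 5) := by
  have hn0 : n ≠ 0 := by omega
  rw [lmrR, lmrS]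
  have hc0 : (1 + Polynomial.X ^ n : k[X]).coeff 0 = 1 := by
    rw [Polynomial.coeff_add, Polynomial.coeff_one_zero, Polynomial.coeff_X_pow, if_neg hn0.symm,
      add_zero]
  rw [hc0, map_one]
  simp only [one_pow, mul_one, add_sub_cancel_left]
  rw [Finset.mul_sum, Polynomial.finsetSum_coeff]
  have hterm : ∀ i, (Polynomial.C c * Polynomial.X ^ (n - 1) * (-Polynomial.X ^ n) ^ i : k[X]).coeff
      (lmrDegM n) = if lmrDegM n = n * i + (n - 1) then c * (-1) ^ i else 0 := by
    intro i
    have : (Polynomial.C c * Polynomial.X ^ (n - 1) * (-Polynomial.X ^ n) ^ i : k[X]) =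
        Polynomial.C (c * (-1) ^ i) * Polynomial.X ^ (n * i + (n - 1)) := by
      rw [neg_pow, ← pow_mul, map_mul, map_pow, map_neg, map_one, pow_add]
      ring
    rw [this, Polynomial.coeff_C_mul_X_pow]
  rw [Finset.sum_congr rfl fun i _ => hterm i, Finset.sum_eq_single (2 * n - 5)]
  · rw [if_pos (lmrDegM_eq hn)]
  · intro i _ hi
    rw [if_neg]
    rw [lmrDegM_eq hn]
    intro h
    have h' : n * (2 * n - 5) = n * i := by omega
    exact hi (Nat.eq_of_mul_eq_mul_left (by omega) h').symm
  · intro h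
    exfalso
    rw [Finset.mem_range, lmrDegM_eq hn] at h
    apply h
    nlinarith

/-- **`E` on the witness**: `E(W_n) = (n(n−1))² 2^{2n−1} (−1)^{2n−5}`.
[cite: LandsbergManivelRessayre2013, §2.3 (the equation of the flag, evaluated at the test form)] -/
theorem lmrEq_lmrWitness (hn : 3 ≤ n) (hinj : Function.Injective
      (Fin.cons x (Fin.cons y z : Fin (2 * n - 1 + 1) → ι) : Fin (2 * n - 1 + 2) → ι)) :
    lmrEq (Fin.cons x (Fin.cons y z : Fin (2 * n - 1 + 1) → ι) : Fin (2 * n - 1 + 2) → ι)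
        (lmrDegM n) (lmrWitness (k := k) n x y z) =
      (((n : k) * ((n - 1 : ℕ) : k)) ^ 2 * 2 ^ (2 * n - 1)) * (-1) ^ (2 * n - 5) := by
  have hxy : x ≠ y := by
    intro h
    have := @hinj 0 1 (by simp [h])
    exact Fin.zero_ne_one this
  have hzx : ∀ c, z c ≠ x := by
    intro c h
    have := @hinj c.succ.succ 0 (by simp [h])
    exact Fin.succ_ne_zero _ this
  have hzy : ∀ c, z c ≠ y := by
    intro c h
    have := @hinj c.succ.succ 1 (by simp [h])
    exact Fin.succ_ne_zero _ (Fin.succ_injective _ this)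
  rw [lmrEq]
  have h0 : (Fin.cons x (Fin.cons y z : Fin (2 * n - 1 + 1) → ι) : Fin (2 * n - 1 + 2) → ι) 0 = x := rfl
  have h1 : (Fin.cons x (Fin.cons y z : Fin (2 * n - 1 + 1) → ι) : Fin (2 * n - 1 + 2) → ι) 1 = y := rfl
  rw [h0, h1, planeRestr_lmrWitness hxy hzx hzy, planeRestr_hessGenMinor_selMatrix]
  have hmat : (Matrix.of fun a b => planeRestr (A := k) x y
      (pderiv ((Fin.cons x (Fin.cons y z : Fin (2 * n - 1 + 1) → ι) : Fin (2 * n - 1 + 2) → ι) a)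
        (pderiv ((Fin.cons x (Fin.cons y z : Fin (2 * n - 1 + 1) → ι) :
          Fin (2 * n - 1 + 2) → ι) b) (lmrWitness (k := k) n x y z)))) =
      Matrix.diagonal (witnessDiag (k := k) n) := by
    refine Matrix.ext fun a b => ?_
    rw [Matrix.of_apply]
    exact planeRestr_pderiv_pderiv_lmrWitness (k := k) hinj a b
  rw [hmat, det_diagonal_witnessDiag hn, lmrR_one_add_X_pow hn]

/-- **`E(W_n) ≠ 0` in characteristic zero.**
[cite: LandsbergManivelRessayre2013, §2.3 (the equation of the flag is not identically zero)] -/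
theorem lmrEq_lmrWitness_ne_zero [CharZero k] (hn : 3 ≤ n) (hinj : Function.Injective
      (Fin.cons x (Fin.cons y z : Fin (2 * n - 1 + 1) → ι) : Fin (2 * n - 1 + 2) → ι)) :
    lmrEq (Fin.cons x (Fin.cons y z : Fin (2 * n - 1 + 1) → ι) : Fin (2 * n - 1 + 2) → ι)
        (lmrDegM n) (lmrWitness (k := k) n x y z) ≠ 0 := by
  rw [lmrEq_lmrWitness hn hinj]
  have h1 : (n : k) ≠ 0 := by exact_mod_cast (show n ≠ 0 by omega)
  have h2 : ((n - 1 : ℕ) : k) ≠ 0 := by exact_mod_cast (show n - 1 ≠ 0 by omega)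
  have h3 : (2 : k) ^ (2 * n - 1) ≠ 0 := pow_ne_zero _ two_ne_zero
  have h4 : (-1 : k) ^ (2 * n - 5) ≠ 0 := pow_ne_zero _ (neg_ne_zero.mpr one_ne_zero)
  exact mul_ne_zero (mul_ne_zero (pow_ne_zero _ (mul_ne_zero h1 h2)) h3) h4

end Witness

/-! ### §10 The theorem: `I(Δ(det_n))` has a nonzero highest-weight vector in degree `2n(n−1)` -/

section Main

open _root_.Literature.NumberTheory.DiophantineGeometry

variable {n : ℕ}

/-- `2n + 1 ≤ n²` for `n ≥ 3`: a `(2n+1)`-dimensional coordinate subspace `F ⊂ M_n` exists. [cite: LandsbergManivelRessayre2013, §3.1 (`k + 3 = 2n + 1 ≤ N = n²`)] -/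
theorem two_mul_sub_one_add_two_le_sq (hn : 3 ≤ n) : 2 * n - 1 + 2 ≤ n * n := by
  obtain ⟨j, rfl⟩ := Nat.exists_eq_add_of_le' hn
  have : 2 * (j + 3) - 1 + 2 = 2 * j + 7 := by omega
  rw [this]
  nlinarith

/-- **The LMR flag of `det_n`**: the `2n + 1` GREATEST matrix positions in lexicographic order,
descending — `f 0 = topMatIdx n` (the greatest index, BIP's `e_1` in the dual, greatest-index
convention of `coordRep`, cf. `revMatIdx`), `f 1` the next one, then `2n − 1` more — i.e. the
coordinate flag `D = ⟨e_{f 0}⟩ ⊂ L = ⟨e_{f 0}, e_{f 1}⟩ ⊂ F = ⟨e_{f 0}, …, e_{f (2n)}⟩`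
(`dim F = k + 3 = 2n + 1`, `k = 2n − 2 = dim Z(det_n)^∨`) adapted to the Borel of upper-triangular
matrices acting contragrediently on `k[Sym^n]` (`n ≥ 3`, so that `2n + 1 ≤ n²`).
[cite: LandsbergManivelRessayre2013, §2.3 ("Consider a basis adapted to `D ⊂ L ⊂ F`") + §3.1] -/
def lmrFlag (n : ℕ) (hn : 3 ≤ n) : Fin (2 * n - 1 + 2) → MatIdx n :=
  fun a => matIdxEquiv n (Fin.rev (Fin.castLE (two_mul_sub_one_add_two_le_sq hn) a))

/-- Unfolding: `lmrFlag n hn a` is the `a`-th greatest matrix index (`= revMatIdx n (castLE a)` of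
`PlethysmStabilityBIP.lean`, by `rfl`). [cite: LandsbergManivelRessayre2013, §2.3] -/
theorem lmrFlag_apply (hn : 3 ≤ n) (a : Fin (2 * n - 1 + 2)) :
    lmrFlag n hn a = matIdxEquiv n (Fin.rev (Fin.castLE (two_mul_sub_one_add_two_le_sq hn) a)) :=
  rfl

/-- The LMR flag consists of distinct coordinates. [cite: LandsbergManivelRessayre2013, §2.3] -/
theorem lmrFlag_injective (hn : 3 ≤ n) : Function.Injective (lmrFlag n hn) := by
  intro a b h
  have h' := Fin.rev_injective ((matIdxEquiv n).injective h)
  exact Fin.castLE_injective _ h'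

/-- `lmrFlag n hn 0 = topMatIdx n`: the line `D` of the flag is spanned by the greatest coordinate.
[cite: LandsbergManivelRessayre2013, §2.3] -/
theorem lmrFlag_zero (hn : 3 ≤ n) [NeZero n] :
    lmrFlag n hn 0 = _root_.Literature.Computability.Complexity.topMatIdx n := by
  rw [lmrFlag_apply, _root_.Literature.Computability.Complexity.topMatIdx]
  congr 1

/-- **Landsberg–Manivel–Ressayre's degree statement, as a theorem (no cited fact).** For every
`n ≥ 3` the ideal of `GL_{n²} · det_n` in `ℂ[Sym^n(ℂ^{n²})]` contains a NONZERO highest-weight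
vector (for the lexicographic upper Borel of `GL_{n²}`), homogeneous of degree `2n(n−1)`: the
orbit closure `Δ(det_n)` has an equation of degree `2n(n−1)` (LMR 2013 Thm. 1.1.2 (1) / §3.1:
`24` for `det_4`, `40` for `det_5`, `60` for `det_6`). Proof: LMR's degenerate-dual equation
`E = R̂_M(P_L(1,Y), det(H_P|_F)_L(1,Y))` (§§1–2) vanishes on the orbit because every `g · det_n`
is prime and its Hessian has rank `≤ 2n` on its zero set, so it divides `det(H|_F)`
(Nullstellensatz) (§4); `E` is a homogeneous polynomial function of degree `2n(n−1)` on `Sym^n`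
(§§5–6); it does not vanish at `x^n + y^n + z_0² x^{n−3} y + Σ z_c² x^{n−2}` (§9); the stable
finite-dimensional space `ℂ[Sym^n]_{2n(n−1)} ∩ I` then contains a highest-weight vector
(`exists_hwv_of_mem_orbitVanishingIdeal`).
[cite: LandsbergManivelRessayre2013, Thm. 1.1.2 (1) (p. 470) with §3.1–3.2 (p. 476: "local equations
at `[det_n]` of `\\overline{GL_{n²}·[det_n]}`, of degree `2n(n−1)`")] -/
theorem exists_hwv_idealDet (hn : 3 ≤ n) :
    ∃ (χ : Weight (MatIdx n)) (F : MvPolynomial (DegIdx (MatIdx n) n) ℂ),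
      F ∈ highestWeightSpace (coordRep (MatIdx n) ℂ n) χ ∧
        F ∈ orbitVanishingIdeal (detFormLex ℂ n) n ∧ F ≠ 0 ∧ F.IsHomogeneous (2 * n * (n - 1)) := by
  set f := lmrFlag n hn with hf
  have hcons : (Fin.cons (f 0) (Fin.cons (f 1) (fun c => f c.succ.succ) :
      Fin (2 * n - 1 + 1) → MatIdx n) : Fin (2 * n - 1 + 2) → MatIdx n) = f := by
    funext a
    cases a using Fin.cases with
    | zero => rfl
    | succ a' =>
      cases a' using Fin.cases with
      | zero => rfl
      | succ c => rfl
  have hinj : Function.Injective (Fin.cons (f 0) (Fin.cons (f 1) (fun c => f c.succ.succ) :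
      Fin (2 * n - 1 + 1) → MatIdx n) : Fin (2 * n - 1 + 2) → MatIdx n) := by
    rw [hcons]
    exact lmrFlag_injective hn
  have hE := lmrEq_lmrWitness_ne_zero (k := ℂ) hn hinj
  rw [hcons] at hE
  exact exists_hwv_idealDet_of_witness hn f (lmrWitness_isHomogeneous (k := ℂ) hn _ _ _) hE


/-- **Partition form.** For every `n ≥ 3` there is a partition `λ ⊢ n · 2n(n−1)` with at most `n²`
parts such that the type `λ` (dual weight `λ^*`, the convention of
`PerDetMultiplicityObstructionAt`) carries an equation of `Δ(det_n)` in degree `2n(n−1)`: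
`#eq_{λ^*} ≥ 1` and `mult_{λ^*} ℂ[Δ(det_n)] < a_{λ^*}` — the least degree `e(n)` in which the ideal
of `\overline{GL_{n²} · det_n}` is nonzero satisfies `e(n) ≤ 2n(n−1)`, by theorem. (Which `λ`:
Landsberg–Manivel–Ressayre's `(2n³−4n²+1, 2n²−4n+1, 2^{2n−1})`, `LMRDetIdealModule.lean`; the
identification of the weight is not carried out in this file.)
[cite: LandsbergManivelRessayre2013, Thm. 1.1.2 (1) (p. 470) with §3.2 (p. 476)] -/
theorem exists_partition_hwv_idealDet (hn : 3 ≤ n) :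
    ∃ (lam : Nat.Partition (n * (2 * n * (n - 1)))) (F : MvPolynomial (DegIdx (MatIdx n) n) ℂ),
      lam.parts.card ≤ n * n ∧
      F ∈ highestWeightSpace (coordRep (MatIdx n) ℂ n)
          (Weight.dualOfPartition (n * n) lam).toMatIdx ∧
        F ∈ orbitVanishingIdeal (detFormLex ℂ n) n ∧ F ≠ 0 ∧
      orbitMultiplicity ℂ (detFormLex ℂ n) n (Weight.dualOfPartition (n * n) lam).toMatIdx <
        plethysmCoeff ℂ (MatIdx n) n (Weight.dualOfPartition (n * n) lam).toMatIdx := by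
  haveI : Infinite ℂ := CharZero.infinite ℂ
  haveI : NeZero n := ⟨by omega⟩
  obtain ⟨χ, F, hF, hFI, hF0, hFd⟩ := exists_hwv_idealDet hn
  have hsize := size_eq_of_mem_highestWeightSpace_of_isHomogeneous hF hF0 hFd
  have hHW : HasHighestWeight (coordRep (MatIdx n) ℂ n) χ :=
    (hasHighestWeight_iff_exists _ _).mpr ⟨F, hF0, hF⟩
  obtain ⟨f', -, hf'⟩ := exists_hasHighestWeight_orbitCoordRep_of_hasHighestWeight_coordRep hHW
  obtain ⟨lam', hlamN, hlam⟩ :=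
    exists_eq_dualOfPartition_of_hasHighestWeight_orbitCoordRep_of_size_eq (matIdxEquiv n) f' hf'
      hsize
  let lam : Nat.Partition (n * (2 * n * (n - 1))) :=
    ⟨lam'.parts, lam'.parts_pos, by rw [lam'.parts_sum, mul_comm]⟩
  have hχ : χ = (Weight.dualOfPartition (n * n) lam).toMatIdx := by rw [hlam]; rfl
  refine ⟨lam, F, hlamN, hχ ▸ hF, hFI, hF0, ?_⟩
  rw [← hχ]
  exact orbitMultiplicity_lt_plethysmCoeff_of_mem_orbitVanishingIdeal (NeZero.ne n) hF hFI hF0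

end Main

end Literature.Computability.AlgebraicComplexity
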